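/-
Copyright (c) 2026 the pub-hodgecm-mathlib formalisation cell (harness21).  Prover seat hodgecm-mathlib-K2E3-p14 (g3) ((SC-an) line lead), HCML Track B «K2-LIT»
(build stream 29), h413 = `stmt-HodgeConjecture-24833`, line `K2_E3_EllipticInputs`, unit U12 «Characters», socket #11 road (11-SC), letter (SC-an), END-GAME MAP v2 piece
(M5e-2) «THE DEPTH OF A REGULAR DIAGONAL ELEMENT FROM ITS DISCRIMINANT» (RULINGS #3 (C4), `K2/STATUS.md` 2026-09-04T02:43:36Z).  2026-09-04.
-/
import Literature.Algebra.Polynomial.DiscriminantRootProduct                   -- ★ `discr_prod_X_sub_C_eq_prod_prod_Ioi_sq` (`D(∏ (X − ξᵢ)) = ∏_{i<j} (ξⱼ − ξᵢ)²`)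
import Literature.NumberTheory.Automorphic.AddCharConductorExponent            -- ★ `normAbs_le_normAbs_iff` (`‖x‖ ≤ ‖y‖ ↔ v x ≤ v y`); brings ★ `normAbs`, `normAbs_le_one_iff`
import Literature.NumberTheory.Automorphic.GL2UnramifiedLFactorDivisibility    -- ★ `normAbs_eq_inv_of_isUniformizingElement` (`‖ϖ‖ = q⁻¹`)
import Literature.NumberTheory.Automorphic.ValuedFieldValuativeRelBridge       -- ★ `v_le_iff_valuation_le`, `v_le_one_iff_valuation_le_one`, `isUniformizingElement_of_v_eq`
import Literature.NumberTheory.Automorphic.ReductiveGroupData                  -- ★ `glDiagonal`, `coe_glDiagonal`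
import Mathlib.LinearAlgebra.Matrix.Charpoly.Coeff
import HarnessLib

/-!
# K2_E3 road (h413), socket #11 (SC-an), END-GAME MAP v2 piece (M5e-2): THE DEPTH OF A REGULAR DIAGONAL ELEMENT OF `U(2,1)` FROM ITS DISCRIMINANT —
# `D(diag d) = ((d₁−d₀)(d₂−d₀)(d₂−d₁))²`, and on the height ball `Ω_m`: `|ϖ^μ| ≤ |D| ⇒ |ϖ^{μ+4m}| ≤ |dᵢ − dₖ|`, `‖ϖ‖^τ ≤ T(t) ⇒ |ϖ^{4τ+10m}| ≤ |dᵢ − dₖ|`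
# (Harish-Chandra 1970, Part VII §2 p. 69 (`q^{λ(x)} = |D(x)|`), §3 p. 71; Rogawski 1990, §3.1 p. 19)

Cell `pub/hodgecm-mathlib`, Track B «K2-LIT», crux H413 = `stmt-HodgeConjecture-24833` (`--supports … --as helper`, count-neutral).  THEOREMS ONLY (no `def`, no
`instance`, no `notation`, no named-fact hypothesis, no `sorry`).

WHY.  The (SC-dom) bricks of the line state their bounds in the DEPTH currency `λ` of a regular diagonal `t = diag d` — «`∀ i ≠ k, v(ϖ^λ) ≤ v(dᵢ − dₖ)`» ((M5b) ★-bound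
`K2E3TruncatedCharTorusSlicing`, (M5c) ★ `K2E3ConjugatorHeightControlRankOne`, (M5d) ★ p856849) — with constants POLYNOMIAL in `λ`; the domination weight of ★
`K2E3SupercuspidalTruncatedCharDominationOfBricks` is `W = c |D_G|^{-1∕2} (1 + |log|D_G||)^k` in the DISCRIMINANT TOKEN of the ★ HC-D road
(`T(g) = √√(‖disc χ_g‖ · ‖det g‖⁻²) = |D_G(g)|^{1∕2}`, ★ `locallyIntegrable_weylDiscr_inv*`).  This file is the dictionary `λ ≲ |log_q T| + O(m)` on the height ball `Ω_m`:
* §1 ALGEBRA: `charpoly_discr_diagonal_fin_three` — `disc χ_{diag d} = ((d₁−d₀)(d₂−d₀)(d₂−d₁))²` (★ `discr_prod_X_sub_C_eq_prod_prod_Ioi_sq` ∘ `Matrix.charpoly_diagonal`); `det (diag d) = d₀d₁d₂`.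
* §2 VALUATIONS (`Valued K ℤᵐ⁰`, `t ∈ Ω_m` read on the diagonal: `|ϖ^m dᵢ|, |ϖ^m dᵢ⁻¹| ≤ 1`): `v_pow_mul_sub_le_one` (`|ϖ^m (dᵢ − dₖ)| ≤ 1`), **`v_pow_le_v_sub_sq_of_v_pow_le_v_discr`**
  (`|ϖ^μ| ≤ |((d₁−d₀)(d₂−d₀)(d₂−d₁))²| ⇒ |ϖ^{μ+4m}| ≤ |(dᵢ − dₖ)²|`: the other two root differences are each `≤ q^m`), **`v_pow_le_v_sub_of_v_pow_le_v_discr`** (`⇒ |ϖ^{μ+4m}| ≤ |dᵢ − dₖ|`).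
* §3 THE TOKEN (`K` a non-archimedean local field with compatible `Valued`∕`ValuativeRel`, `|ϖ| = exp(−1)`): `pow_normAbs_le_normAbs_of_v_pow_mul_inv_le_one` (`‖ϖ‖^m ≤ ‖dᵢ‖`),
  **`v_pow_le_v_discr_of_pow_normAbs_le_token`** (`‖ϖ‖^τ ≤ T(t) ⇒ |ϖ^{4τ+6m}| ≤ |disc χ_t|`, as `‖det t‖ ≥ ‖ϖ‖^{3m}`) and the consumer form
  **`v_pow_le_v_sub_of_pow_normAbs_le_token`**: `‖ϖ‖^τ ≤ T(t) ⇒ ∀ i ≠ k, v(ϖ^{4τ+10m}) ≤ v(dᵢ − dₖ)` — i.e. the depth `λ(t) ≤ 4τ + 10m` whenever `T(t) ≥ q^{−τ}`.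

HONEST LABEL: HC_CM is proved only modulo the 7 printed citations (2 remaining named inputs: hLiu418 = `stmt-HodgeConjecture-24832`, h413 =
`stmt-HodgeConjecture-24833`) until rung 0 closes; this file is a count-neutral helper (valuation bookkeeping; nothing printed is asserted as a fact).

## References
* [HarishChandra1970] Harish-Chandra (notes by G. van Dijk), *Harmonic Analysis on Reductive p-adic Groups*, LNM 162 (1970), Part VII §2 p. 69 (`q^{λ(x)} = |D(x)|`, Cor. of
  Thm 18), §3 pp. 71–72 (`Ω(γ)`, `(1+|λ(γ)|)^{4ℓ}`).
* [Rogawski1990] J. D. Rogawski, *Automorphic Representations of Unitary Groups in Three Variables*, Ann. of Math. Stud. 123 (1990), §3.1 p. 19 (regular elements, `D_G`).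
-/

set_option autoImplicit false
-- the mandated namespace repeats the single-problem summit's segment (`HodgeConjecture.HodgeConjecture`)
set_option linter.dupNamespace false

noncomputable section

open Polynomial Finset
open scoped NNReal MatrixGroups WithZero
open Literature.NumberTheory.Automorphic Literature.NumberTheory.GaloisRepresentations Literature.NumberTheory.GaloisRepresentations.IsNonarchimedeanLocalField

namespace Summit.HodgeConjecture.HodgeConjecture.Cruxes.H413.K2E3SplitTorusDepthFromDiscriminant

/-! ## §1 Algebra: the discriminant and the determinant of a diagonal `3 × 3` matrix -/

section Algebra

variable {K : Type*} [Field K]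

/-- `∏_{i<j} (dⱼ − dᵢ)²` on `Fin 3`, written out. [cite: Rogawski1990, §3.1 p. 19] -/
theorem prod_prod_Ioi_sub_sq_fin_three (d : Fin 3 → K) :
    ∏ i : Fin 3, ∏ j ∈ Ioi i, (d j - d i) ^ 2 = ((d 1 - d 0) * (d 2 - d 0) * (d 2 - d 1)) ^ 2 := by
  rw [Fin.prod_univ_three]
  have h0 : Ioi (0 : Fin 3) = {1, 2} := by decide
  have h1 : Ioi (1 : Fin 3) = {2} := by decide
  have h2 : Ioi (2 : Fin 3) = ∅ := by decide
  rw [h0, h1, h2, prod_pair (by decide), prod_singleton, prod_empty]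
  ring

/-- **`disc χ_{diag(d₀,d₁,d₂)} = ((d₁−d₀)(d₂−d₀)(d₂−d₁))²`** (`χ_{diag d} = ∏ (X − dᵢ)`, Mathlib `Matrix.charpoly_diagonal`; ★ `discr_prod_X_sub_C_eq_prod_prod_Ioi_sq`).
[cite: Rogawski1990, §3.1 p. 19] -/
theorem charpoly_discr_diagonal_fin_three (d : Fin 3 → K) :
    (Matrix.diagonal d).charpoly.discr = ((d 1 - d 0) * (d 2 - d 0) * (d 2 - d 1)) ^ 2 := by
  rw [Matrix.charpoly_diagonal, Literature.Algebra.Polynomial.DiscriminantRootProduct.discr_prod_X_sub_C_eq_prod_prod_Ioi_sq,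
    prod_prod_Ioi_sub_sq_fin_three]

/-- The same for the torus element `glDiagonal 3 K d ∈ GL₃(K)` (★ `coe_glDiagonal`). [cite: Rogawski1990, §3.1 p. 19] -/
theorem charpoly_discr_coe_glDiagonal (d : Fin 3 → Kˣ) :
    ((glDiagonal 3 K d : GL (Fin 3) K) : Matrix (Fin 3) (Fin 3) K).charpoly.discr =
      (((d 1 : K) - d 0) * ((d 2 : K) - d 0) * ((d 2 : K) - d 1)) ^ 2 := by
  rw [coe_glDiagonal, charpoly_discr_diagonal_fin_three]

/-- `det (glDiagonal 3 K d) = d₀ d₁ d₂`. [cite: Rogawski1990, §3.1 p. 19] -/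
theorem det_coe_glDiagonal (d : Fin 3 → Kˣ) :
    ((glDiagonal 3 K d : GL (Fin 3) K) : Matrix (Fin 3) (Fin 3) K).det = (d 0 : K) * d 1 * d 2 := by
  rw [coe_glDiagonal, Matrix.det_diagonal, Fin.prod_univ_three]

end Algebra

/-! ## §2 Valuations on the height ball `Ω_m`: depth of the root differences from the depth of the discriminant -/

section Valued

variable {K : Type*} [Field K] [Valued K ℤᵐ⁰]

/-- On `Ω_m` every root difference is bounded: `|ϖ^m dᵢ|, |ϖ^m dₖ| ≤ 1 ⇒ |ϖ^m (dᵢ − dₖ)| ≤ 1` (ultrametric). [cite: HarishChandra1970, Part VII §2 p. 69] -/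
theorem v_pow_mul_sub_le_one {ϖ a b : K} {m : ℕ} (ha : Valued.v (ϖ ^ m * a) ≤ 1) (hb : Valued.v (ϖ ^ m * b) ≤ 1) :
    Valued.v (ϖ ^ m * (a - b)) ≤ 1 := by
  rw [mul_sub]
  exact Valuation.map_sub_le _ ha hb

/-- The core inequality: `|ϖ^μ| ≤ |(x y z)²|` with `|ϖ^m y|, |ϖ^m z| ≤ 1` gives `|ϖ^{μ+4m}| ≤ |x²|` (`|ϖ^{μ+4m}| = |ϖ^μ|·|ϖ^{4m}| ≤ |(xyz)²|·|ϖ^{4m}| =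
|x²|·|(ϖ^m y · ϖ^m z)²| ≤ |x²|`). [cite: HarishChandra1970, Part VII §3 p. 71] -/
theorem v_pow_le_v_sq_of_v_pow_le_v_mul_sq {ϖ x y z : K} {μ m : ℕ} (hy : Valued.v (ϖ ^ m * y) ≤ 1) (hz : Valued.v (ϖ ^ m * z) ≤ 1)
    (hΔ : Valued.v (ϖ ^ μ) ≤ Valued.v ((x * y * z) ^ 2)) : Valued.v (ϖ ^ (μ + 4 * m)) ≤ Valued.v (x ^ 2) := by
  have hyz2 : Valued.v (((ϖ ^ m * y) * (ϖ ^ m * z)) ^ 2) ≤ 1 := by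
    rw [map_pow, map_mul]; exact pow_le_one' (mul_le_one' hy hz) 2
  calc Valued.v (ϖ ^ (μ + 4 * m)) = Valued.v (ϖ ^ μ) * Valued.v (ϖ ^ (4 * m)) := by rw [← map_mul, ← pow_add]
    _ ≤ Valued.v ((x * y * z) ^ 2) * Valued.v (ϖ ^ (4 * m)) := mul_le_mul' hΔ le_rfl
    _ = Valued.v (x ^ 2) * Valued.v (((ϖ ^ m * y) * (ϖ ^ m * z)) ^ 2) := by
        rw [← map_mul, ← map_mul]; congr 1; ring
    _ ≤ Valued.v (x ^ 2) * 1 := mul_le_mul' le_rfl hyz2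
    _ = Valued.v (x ^ 2) := mul_one _

/-- From the square to the element: `|ϖ| ≤ 1`, `|ϖ^n| ≤ |x²| ⇒ |ϖ^n| ≤ |x|` (if `|x| ≥ 1` trivially, else `|x|² ≤ |x|`). [cite: HarishChandra1970, Part VII §3 p. 71] -/
theorem v_pow_le_v_of_v_pow_le_v_sq {ϖ x : K} {n : ℕ} (hϖ1 : Valued.v ϖ ≤ 1) (h : Valued.v (ϖ ^ n) ≤ Valued.v (x ^ 2)) :
    Valued.v (ϖ ^ n) ≤ Valued.v x := by
  by_cases hx : Valued.v x ≤ 1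
  · refine h.trans ?_
    rw [map_pow, pow_two]
    calc Valued.v x * Valued.v x ≤ Valued.v x * 1 := mul_le_mul' le_rfl hx
      _ = Valued.v x := mul_one _
  · rw [map_pow]
    exact (pow_le_one' hϖ1 n).trans (le_of_not_ge hx)

/-- **DEPTH OF THE ROOT DIFFERENCES FROM THE DEPTH OF THE DISCRIMINANT, SQUARED FORM**: on `Ω_m` (`|ϖ^m dᵢ| ≤ 1` for all `i`), if `|ϖ^μ| ≤ |((d₁−d₀)(d₂−d₀)(d₂−d₁))²|`
then `|ϖ^{μ+4m}| ≤ |(dᵢ − dₖ)²|` for every `i ≠ k` — the two OTHER root differences are each `≤ q^m`. [cite: HarishChandra1970, Part VII §3 p. 71] [cite: Rogawski1990, §3.1 p. 19] -/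
theorem v_pow_le_v_sub_sq_of_v_pow_le_v_discr {ϖ : K} {d : Fin 3 → K} {m μ : ℕ} (hd : ∀ i, Valued.v (ϖ ^ m * d i) ≤ 1)
    (hΔ : Valued.v (ϖ ^ μ) ≤ Valued.v (((d 1 - d 0) * (d 2 - d 0) * (d 2 - d 1)) ^ 2)) {i k : Fin 3} (hik : i ≠ k) :
    Valued.v (ϖ ^ (μ + 4 * m)) ≤ Valued.v ((d i - d k) ^ 2) := by
  have hs : ∀ a b : Fin 3, Valued.v (ϖ ^ m * (d a - d b)) ≤ 1 := fun a b => v_pow_mul_sub_le_one (hd a) (hd b)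
  -- each ordered pair: `((d₁−d₀)(d₂−d₀)(d₂−d₁))² = ((dᵢ−dₖ)·y·z)²` with `y`, `z` the two other differences
  have aux : ∀ x y z : K, Valued.v (ϖ ^ m * y) ≤ 1 → Valued.v (ϖ ^ m * z) ≤ 1 →
      ((d 1 - d 0) * (d 2 - d 0) * (d 2 - d 1)) ^ 2 = (x * y * z) ^ 2 → Valued.v (ϖ ^ (μ + 4 * m)) ≤ Valued.v (x ^ 2) := by
    intro x y z hy hz hxyz
    exact v_pow_le_v_sq_of_v_pow_le_v_mul_sq hy hz (hxyz ▸ hΔ)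
  fin_cases i <;> fin_cases k
  · exact absurd rfl hik
  · show Valued.v (ϖ ^ (μ + 4 * m)) ≤ Valued.v ((d 0 - d 1) ^ 2)
    exact aux _ _ _ (hs 2 0) (hs 2 1) (by ring)
  · show Valued.v (ϖ ^ (μ + 4 * m)) ≤ Valued.v ((d 0 - d 2) ^ 2)
    exact aux _ _ _ (hs 1 0) (hs 2 1) (by ring)
  · show Valued.v (ϖ ^ (μ + 4 * m)) ≤ Valued.v ((d 1 - d 0) ^ 2)
    exact aux _ _ _ (hs 2 0) (hs 2 1) (by ring)
  · exact absurd rfl hik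
  · show Valued.v (ϖ ^ (μ + 4 * m)) ≤ Valued.v ((d 1 - d 2) ^ 2)
    exact aux _ _ _ (hs 1 0) (hs 2 0) (by ring)
  · show Valued.v (ϖ ^ (μ + 4 * m)) ≤ Valued.v ((d 2 - d 0) ^ 2)
    exact aux _ _ _ (hs 1 0) (hs 2 1) (by ring)
  · show Valued.v (ϖ ^ (μ + 4 * m)) ≤ Valued.v ((d 2 - d 1) ^ 2)
    exact aux _ _ _ (hs 1 0) (hs 2 0) (by ring)
  · exact absurd rfl hik

/-- **DEPTH OF THE ROOT DIFFERENCES FROM THE DEPTH OF THE DISCRIMINANT**: on `Ω_m`, `|ϖ^μ| ≤ |((d₁−d₀)(d₂−d₀)(d₂−d₁))²| ⇒ ∀ i ≠ k, |ϖ^{μ+4m}| ≤ |dᵢ − dₖ|` — the DEPTH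
`λ(t) ≤ μ + 4m` in the line's convention «`∀ i ≠ k, v(ϖ^λ) ≤ v(dᵢ − dₖ)`» (RULINGS #3 (C2)). [cite: HarishChandra1970, Part VII §3 p. 71] [cite: Rogawski1990, §3.1 p. 19] -/
theorem v_pow_le_v_sub_of_v_pow_le_v_discr {ϖ : K} (hϖ1 : Valued.v ϖ ≤ 1) {d : Fin 3 → K} {m μ : ℕ} (hd : ∀ i, Valued.v (ϖ ^ m * d i) ≤ 1)
    (hΔ : Valued.v (ϖ ^ μ) ≤ Valued.v (((d 1 - d 0) * (d 2 - d 0) * (d 2 - d 1)) ^ 2)) {i k : Fin 3} (hik : i ≠ k) :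
    Valued.v (ϖ ^ (μ + 4 * m)) ≤ Valued.v (d i - d k) :=
  v_pow_le_v_of_v_pow_le_v_sq hϖ1 (v_pow_le_v_sub_sq_of_v_pow_le_v_discr hd hΔ hik)

end Valued

/-! ## §3 The discriminant token `T(t) = √√(‖disc χ_t‖·‖det t‖⁻²)` of the ★ HC-D road -/

section Token

variable {K : Type*} [Field K] [Valued K ℤᵐ⁰] [ValuativeRel K] [(Valued.v : Valuation K ℤᵐ⁰).Compatible] [IsNonarchimedeanLocalField K]

/-- On `Ω_m` the torus entries are not too small: `|ϖ^m dᵢ⁻¹| ≤ 1 ⇒ ‖ϖ‖^m ≤ ‖dᵢ‖` (normalised absolute value ★ `normAbs`).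
[cite: HarishChandra1970, Part VII §2 p. 69] -/
theorem pow_normAbs_le_normAbs_of_v_pow_mul_inv_le_one {ϖ : K} {x : K} (hx : x ≠ 0) {m : ℕ} (h : Valued.v (ϖ ^ m * x⁻¹) ≤ 1) :
    normAbs K ϖ ^ m ≤ normAbs K x := by
  have h1 : normAbs K (ϖ ^ m * x⁻¹) ≤ 1 := normAbs_le_one_iff.2 ((v_le_one_iff_mem_integer _).1 h)
  rw [map_mul, map_pow, map_inv₀] at h1
  have hx' : 0 < normAbs K x := pos_iff_ne_zero.2 ((map_ne_zero (normAbs K)).2 hx)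
  rwa [mul_inv_le_iff₀ hx', one_mul] at h1

/-- **THE DISCRIMINANT DEPTH FROM THE TOKEN**: for `t = diag d ∈ Ω_m` (`|ϖ^m dᵢ⁻¹| ≤ 1`) and `τ` with `‖ϖ‖^τ ≤ T(t) = √√(‖disc χ_t‖ · ‖det t‖⁻²)` (i.e. `|D_G(t)|^{1∕2} ≥ q^{−τ}`):
`|ϖ^{4τ+6m}| ≤ |disc χ_t|` — since `‖disc χ_t‖ = T⁴·‖det t‖²` and `‖det t‖ = ‖d₀d₁d₂‖ ≥ ‖ϖ‖^{3m}`. [cite: HarishChandra1970, Part VII §2 p. 69] [cite: Rogawski1990, §3.1 p. 19] -/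
theorem v_pow_le_v_discr_of_pow_normAbs_le_token {ϖ : K} {d : Fin 3 → Kˣ} {m : ℕ} (hd' : ∀ i, Valued.v (ϖ ^ m * ((d i : K))⁻¹) ≤ 1) {τ : ℕ}
    (hT : normAbs K ϖ ^ τ ≤ NNReal.sqrt (NNReal.sqrt
      (normAbs K ((((glDiagonal 3 K d : GL (Fin 3) K) : Matrix (Fin 3) (Fin 3) K)).charpoly.discr) *
        (normAbs K ((((glDiagonal 3 K d : GL (Fin 3) K) : Matrix (Fin 3) (Fin 3) K)).det) ^ 2)⁻¹))) :
    Valued.v (ϖ ^ (4 * τ + 6 * m)) ≤ Valued.v ((((glDiagonal 3 K d : GL (Fin 3) K) : Matrix (Fin 3) (Fin 3) K)).charpoly.discr) := by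
  set A := normAbs K ((((glDiagonal 3 K d : GL (Fin 3) K) : Matrix (Fin 3) (Fin 3) K)).charpoly.discr) with hA
  set B := normAbs K ((((glDiagonal 3 K d : GL (Fin 3) K) : Matrix (Fin 3) (Fin 3) K)).det) with hB
  set r := normAbs K ϖ with hr
  -- `‖det t‖ ≥ ‖ϖ‖^{3m} > 0`
  have hBge : r ^ (3 * m) ≤ B := by
    have h0 := pow_normAbs_le_normAbs_of_v_pow_mul_inv_le_one (d 0).ne_zero (hd' 0)
    have h1 := pow_normAbs_le_normAbs_of_v_pow_mul_inv_le_one (d 1).ne_zero (hd' 1)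
    have h2 := pow_normAbs_le_normAbs_of_v_pow_mul_inv_le_one (d 2).ne_zero (hd' 2)
    rw [hB, det_coe_glDiagonal, map_mul, map_mul, show 3 * m = m + m + m by ring, pow_add, pow_add]
    exact mul_le_mul' (mul_le_mul' h0 h1) h2
  have hBpos : 0 < B := by
    rw [hB]
    exact pos_iff_ne_zero.2 ((map_ne_zero (normAbs K)).2 (by
      rw [det_coe_glDiagonal]; exact mul_ne_zero (mul_ne_zero (d 0).ne_zero (d 1).ne_zero) (d 2).ne_zero))
  -- `‖ϖ‖^{4τ} ≤ A · (B²)⁻¹`, i.e. `‖ϖ‖^{4τ} · B² ≤ A`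
  have h4 : r ^ (4 * τ) ≤ A * (B ^ 2)⁻¹ := by
    have h := hT
    rw [NNReal.le_sqrt_iff_sq_le, NNReal.le_sqrt_iff_sq_le] at h
    rwa [show (4 * τ) = τ * 2 * 2 by ring, pow_mul, pow_mul]
  have h5 : r ^ (4 * τ) * B ^ 2 ≤ A := (le_mul_inv_iff₀ (pow_pos hBpos 2)).1 h4
  -- `A ≥ ‖ϖ‖^{4τ+6m} = ‖ϖ^{4τ+6m}‖`
  have h6 : normAbs K (ϖ ^ (4 * τ + 6 * m)) ≤ A := by
    have h7 : r ^ (4 * τ + 6 * m) = r ^ (4 * τ) * (r ^ (3 * m)) ^ 2 := by ring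
    rw [map_pow, ← hr, h7]
    exact (mul_le_mul' le_rfl (pow_le_pow_left' hBge 2)).trans h5
  exact (v_le_iff_valuation_le _ _).2 (normAbs_le_normAbs_iff.1 h6)

/-- **THE DEPTH OF A REGULAR DIAGONAL ELEMENT FROM ITS DISCRIMINANT TOKEN** (the consumer form): for `t = diag d ∈ U ∩ Ω_m` (`|ϖ^m dᵢ|, |ϖ^m dᵢ⁻¹| ≤ 1`), `|ϖ| = exp(−1)`,
and `τ` with `‖ϖ‖^τ ≤ T(t)` (`|D_G(t)|^{1∕2} ≥ q^{−τ}`): `∀ i ≠ k, v(ϖ^{4τ+10m}) ≤ v(dᵢ − dₖ)` — the depth `λ(t) ≤ 4τ + 10m`, so every bound POLYNOMIAL in `λ` on `Ω_m` is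
polynomial in `|log_q T(t)|` = `½|log_q |D_G(t)||`. [cite: HarishChandra1970, Part VII §2 p. 69; §3 pp. 71–72] [cite: Rogawski1990, §3.1 p. 19] -/
theorem v_pow_le_v_sub_of_pow_normAbs_le_token {ϖ : K} (hϖ : Valued.v ϖ = WithZero.exp (-1 : ℤ)) {d : Fin 3 → Kˣ} {m : ℕ}
    (hd : ∀ i, Valued.v (ϖ ^ m * (d i : K)) ≤ 1) (hd' : ∀ i, Valued.v (ϖ ^ m * ((d i : K))⁻¹) ≤ 1) {τ : ℕ}
    (hT : normAbs K ϖ ^ τ ≤ NNReal.sqrt (NNReal.sqrt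
      (normAbs K ((((glDiagonal 3 K d : GL (Fin 3) K) : Matrix (Fin 3) (Fin 3) K)).charpoly.discr) *
        (normAbs K ((((glDiagonal 3 K d : GL (Fin 3) K) : Matrix (Fin 3) (Fin 3) K)).det) ^ 2)⁻¹)))
    {i k : Fin 3} (hik : i ≠ k) : Valued.v (ϖ ^ (4 * τ + 10 * m)) ≤ Valued.v ((d i : K) - d k) := by
  have hϖ1 : Valued.v ϖ ≤ 1 := by
    rw [hϖ, ← WithZero.exp_zero, WithZero.exp_le_exp]; norm_num
  have hΔ := v_pow_le_v_discr_of_pow_normAbs_le_token hd' hT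
  rw [charpoly_discr_coe_glDiagonal] at hΔ
  have h := v_pow_le_v_sub_of_v_pow_le_v_discr hϖ1 (d := fun i => (d i : K)) hd hΔ hik
  rwa [show 4 * τ + 6 * m + 4 * m = 4 * τ + 10 * m by ring] at h

end Token

end Summit.HodgeConjecture.HodgeConjecture.Cruxes.H413.K2E3SplitTorusDepthFromDiscriminant

end
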